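import Literature.MathematicalPhysics.QuantumLattice.StabilityDecayCalculusProofs
import HarnessLib

/-!
# From Lieb–Robinson-style bounds `C_p / ⌊(ℓ+1)/k⌋^p` to power bounds `B_p / (ℓ+1)^p`

Top-down layer (seat B) of the formalisation of the Michalakis–Zwolak stability theorem
(hubbard.S19, `Literature.MathematicalPhysics.QuantumLattice.michalakis_zwolak`). The reductions
`michalakis_zwolak_of_flow_locality_core` / `…_of_termwise_core` ask for the quasi-local pieces
to be bounded by `B_p / (ℓ + 1)^p` for every `p`, whereas the Lieb–Robinson layers deliver bounds
of the form `C_p / ⌊(ℓ + 1)/(r₀ + 1)⌋^p` for `ℓ ≥ r₀` (`exists_norm_smoothing_sub_twirl_le_div_pow`,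
MZ13 Lemma 1 (iv): the coarse-graining of MZ13 §2, "the restriction of each interaction on a ball
of radius 1 is not crucial, due to coarse-graining") together with a trivial bound `M` for all
`ℓ`. This file converts the latter into the former (`exists_pow_bound_of_floor_bound`):
`B_p = max(C_p, 0) (2k)^p + M k^p`. No definitions, no named facts (theorems only).
-/

noncomputable section

open Finset

namespace Literature.MathematicalPhysics.QuantumLattice

/-- Coarse-graining arithmetic: for `k ≥ 1` and `k ≤ ℓ + 1`, the block index `n = ⌊(ℓ+1)/k⌋ ≥ 1`
satisfies `ℓ + 1 ≤ 2 k n`. [folklore] -/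
theorem succ_le_two_mul_mul_div {k ℓ : ℕ} (hk : 0 < k) (hkℓ : k ≤ ℓ + 1) :
    ℓ + 1 ≤ 2 * k * ((ℓ + 1) / k) := by
  have h1 : 1 ≤ (ℓ + 1) / k := (Nat.le_div_iff_mul_le hk).mpr (by simpa using hkℓ)
  have h2 : ℓ + 1 < k * ((ℓ + 1) / k + 1) := by
    have := Nat.lt_div_mul_add hk (a := ℓ + 1)
    rw [Nat.mul_comm] at this
    linarith [Nat.div_add_mod (ℓ + 1) k, Nat.mod_lt (ℓ + 1) hk]
  nlinarith

/-- **Power bounds from coarse-grained bounds.** If `|g ℓ| ≤ M` for all `ℓ` and, for every `p`,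
`|g ℓ| ≤ C_p / ⌊(ℓ+1)/k⌋^p` whenever `k ≤ ℓ + 1` (`k ≥ 1`), then for every `p` there is `B_p` with
`|g ℓ| ≤ B_p / (ℓ+1)^p` for all `ℓ` (namely `B_p = max(C_p,0)(2k)^p + M k^p`). [folklore] -/
theorem exists_pow_bound_of_floor_bound {g : ℕ → ℝ} {M : ℝ} (hM : ∀ ℓ, |g ℓ| ≤ M) {k : ℕ}
    (hk : 0 < k)
    (h : ∀ p : ℕ, ∃ C : ℝ, ∀ ℓ : ℕ, k ≤ ℓ + 1 → |g ℓ| ≤ C / ((((ℓ + 1) / k : ℕ) : ℝ)) ^ p) :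
    ∀ p : ℕ, ∃ B : ℝ, 0 ≤ B ∧ ∀ ℓ : ℕ, |g ℓ| ≤ B / ((ℓ : ℝ) + 1) ^ p := by
  intro p
  obtain ⟨C, hC⟩ := h p
  have hM0 : 0 ≤ M := (abs_nonneg _).trans (hM 0)
  have hkr : (0 : ℝ) < k := by exact_mod_cast hk
  refine ⟨max C 0 * (2 * k) ^ p + M * (k : ℝ) ^ p, by positivity, fun ℓ => ?_⟩
  have hℓ1 : (0 : ℝ) < (ℓ : ℝ) + 1 := by positivity
  rw [le_div_iff₀ (pow_pos hℓ1 p)]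
  rcases lt_or_ge (ℓ + 1) k with hlt | hge
  · -- small `ℓ`: the trivial bound
    have h1 : ((ℓ : ℝ) + 1) ^ p ≤ (k : ℝ) ^ p := by
      refine pow_le_pow_left₀ hℓ1.le ?_ p
      exact_mod_cast hlt.le
    have h2 : |g ℓ| * ((ℓ : ℝ) + 1) ^ p ≤ M * (k : ℝ) ^ p :=
      mul_le_mul (hM ℓ) h1 (by positivity) hM0
    have h3 : 0 ≤ max C 0 * (2 * (k : ℝ)) ^ p := by positivity
    linarith
  · -- large `ℓ`: the coarse-grained bound with `⌊(ℓ+1)/k⌋ ≥ (ℓ+1)/(2k)`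
    set nb : ℕ := (ℓ + 1) / k with hnb
    have hnb1 : 1 ≤ nb := (Nat.le_div_iff_mul_le hk).mpr (by simpa using hge)
    have hnbr : (0 : ℝ) < nb := by exact_mod_cast hnb1
    have hkey : (ℓ : ℝ) + 1 ≤ 2 * (k : ℝ) * nb := by
      have := succ_le_two_mul_mul_div hk hge
      exact_mod_cast this
    have h1 : |g ℓ| ≤ max C 0 / (nb : ℝ) ^ p :=
      (hC ℓ hge).trans (div_le_div_of_nonneg_right (le_max_left _ _) (by positivity))
    have h2 : ((ℓ : ℝ) + 1) ^ p ≤ (2 * (k : ℝ)) ^ p * (nb : ℝ) ^ p := by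
      rw [← mul_pow]; exact pow_le_pow_left₀ hℓ1.le hkey p
    calc |g ℓ| * ((ℓ : ℝ) + 1) ^ p ≤ max C 0 / (nb : ℝ) ^ p * ((2 * (k : ℝ)) ^ p * (nb : ℝ) ^ p) :=
          mul_le_mul h1 h2 (by positivity) (by positivity)
      _ = max C 0 * (2 * (k : ℝ)) ^ p := by field_simp
      _ ≤ max C 0 * (2 * (k : ℝ)) ^ p + M * (k : ℝ) ^ p := by
          have : 0 ≤ M * (k : ℝ) ^ p := by positivity
          linarith

end Literature.MathematicalPhysics.QuantumLattice
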